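import Summits.Ventures.PercRepro.S1CoreCapSpecSpreadFiveBase

/-!
# PercRepro — TOWARDS THE INSTANCE `ν = 5` OF THE SPREAD SPEC: THE WEIGHT-`4` LINE AND THE FAT POINT (p1, gen 32)

`proofs/P1-S2-CORANK6.md` §4g. On the base lemmas of `S1CoreCapSpecSpreadFiveBase` (restriction of the cost clause to the lines disjoint
from a base; `not_meet_of_cost_three`):
* **a line of weight `4` beside simple 3-point lines leaves room for at most four of them** (`card_le_five_of_weight_four`): at most one of them
  meets it (`base_two_of_meet`: the base `[X, L₁]` has rank `3` and weight `6`, so no further line meets it), and then the rest are disjoint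
  from both (cost `3` ⟹ `≤ 2`), else all are disjoint from it (cost `2` ⟹ `≤ 4`) — this is the case of a simple 4-point line (`4 + 4 = 8`, the
  search's maximiser: the 4-line beside a disjoint `K₄`) and of a single one-fat 3-point line (`2 + 4 = 6`);
* **around a fat point `p`**: every one-fat line passes through the fat point of any other (`fat_line_through`: a one-fat line avoiding `p`
  beside one through `p` has two-line `lineRank 4 − |L' ∩ F|` against weight `8 − |L' ∩ F|`), at most two one-fat lines pass through `p`
  (`not_three_through_fat`: `[F₃, F₂, F₁]` has rank `4` and weight `8`), and two of them leave room for at most two simple lines, all disjoint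
  from both (`card_le_four_of_two_fat`; cap `2 + 2 + 1 + 1 = 6`).
Axioms: standard.
-/

namespace PercRepro

namespace S1

namespace FourCap

variable {β : Type} [DecidableEq β]

section Heavy

variable {w : β → ℕ} {ls : Finset (Finset β)}
  (h1 : ∀ L ∈ ls, ∀ v ∈ L, w v = 1 ∨ w v = 2)
  (h2 : ∀ L ∈ ls, 3 ≤ L.card ∧ wsum w L ≤ 5)
  (h3 : ∀ L ∈ ls, ∀ L' ∈ ls, L ≠ L' → (L ∩ L').card ≤ 1)
  (h4 : ∀ l : List (Finset β), l.Nodup → (∀ L ∈ l, L ∈ ls) → wsum w (unionL l) ≤ 5 + lineRank l)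
  (h7 : ∀ l : List (Finset β), l.Nodup → (∀ L ∈ l, L ∈ ls) → lineRank l ≤ 4 → wsum w (unionL l) ≤ lineRank l + 3)

include h1 h2 h3 in
/-- The two-line base `[X, L₁]` with `X` meeting the weight-`4` line `L₁` in one point, `X` a simple 3-point line, has rank `3` and
`6` points of weight: cost `3`. -/
theorem base_two_of_meet {L₁ X : Finset β} (hL₁ : L₁ ∈ ls) (hX : X ∈ ls) (hne : X ≠ L₁) (hw4 : wsum w L₁ = 4)
    (hc : X.card = 3) (hwX : wsum w X = 3) (hmeet : (X ∩ L₁).Nonempty) :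
    lineRank [X, L₁] = 3 ∧ wsum w (unionL [X, L₁]) = 6 := by
  have hint : (X ∩ L₁).card ≤ 1 := h3 X hX L₁ hL₁ hne
  have hpos : 1 ≤ (X ∩ L₁).card := Finset.card_pos.2 hmeet
  have hsd : (X \ L₁).card + (X ∩ L₁).card = X.card := Finset.card_sdiff_add_card_inter _ _
  have hfX : fat w X = 0 := by
    have := wsum_eq_card_add_fat w X (h1 X hX); omega
  have hwsd : wsum w (X \ L₁) = (X \ L₁).card := by
    have := wsum_sdiff_eq w X L₁ (h1 X hX)
    have := fat_mono w (Finset.sdiff_subset : X \ L₁ ⊆ X)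
    omega
  have hk₁ := (h2 L₁ hL₁).1
  have hwu : wsum w (X ∪ L₁) = wsum w L₁ + wsum w (X \ L₁) := by
    rw [Finset.union_comm]; exact (wsum_union_ge w _ _).symm
  simp only [unionL, lineRank, Finset.union_empty, Finset.sdiff_empty, Finset.inter_empty, Finset.card_empty,
    Nat.zero_add]
  rw [show (2 - min 0 2 : ℕ) = 2 by decide]
  constructor
  · have : min L₁.card 2 = 2 := min_eq_right (by omega)
    have : min (X ∩ L₁).card 2 = (X ∩ L₁).card := min_eq_left (by omega)
    omega
  · omega

include h1 h2 h3 h4 h7 in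
/-- **A line of weight `4` beside simple 3-point lines leaves room for at most four of them**: at most one of them meets `L₁` — and then
every other is disjoint from both (`not_meet_of_cost_three` on the base `[X, L₁]` of cost `3`: `≤ 2` by `card_filter_disjoint_le_two`) —
else all are disjoint from `L₁` (cost `2`: `≤ 4` by `card_filter_disjoint_le_four`). -/
theorem card_le_five_of_weight_four {L₁ : Finset β} (hL₁ : L₁ ∈ ls) (hw4 : wsum w L₁ = 4)
    (hoth : ∀ L ∈ ls, L ≠ L₁ → L.card = 3 ∧ wsum w L = 3) : ls.card ≤ 5 := by
  have hk₁ := (h2 L₁ hL₁).1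
  by_cases hex : ∃ X ∈ ls, X ≠ L₁ ∧ (X ∩ L₁).Nonempty
  · obtain ⟨X, hX, hXne, hmeet⟩ := hex
    obtain ⟨hcX, hwX⟩ := hoth X hX hXne
    obtain ⟨hrank, hwb⟩ := base_two_of_meet h1 h2 h3 hL₁ hX hXne hw4 hcX hwX hmeet
    have hb : ([X, L₁] : List (Finset β)).Nodup := by simp [hXne]
    have hbl : ∀ L ∈ ([X, L₁] : List (Finset β)), L ∈ ls := by simp [hX, hL₁]
    have hD := card_filter_disjoint_le_two h1 h2 h3 h4 hb hbl (by rw [hrank, hwb])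
    have hcover : ls ⊆ ({X, L₁} : Finset (Finset β)) ∪ ls.filter (fun L => Disjoint L (unionL [X, L₁])) := by
      intro Y hY
      rw [Finset.mem_union, Finset.mem_insert, Finset.mem_singleton]
      by_cases hYX : Y = X
      · exact Or.inl (Or.inl hYX)
      by_cases hYL : Y = L₁
      · exact Or.inl (Or.inr hYL)
      refine Or.inr (Finset.mem_filter.2 ⟨hY, ?_⟩)
      rw [Finset.disjoint_iff_inter_eq_empty]
      by_contra hne
      obtain ⟨hcY, hwY⟩ := hoth Y hY hYL
      have ho : (Y ∩ unionL [X, L₁]).card ≤ 2 := by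
        simp only [unionL, Finset.union_empty]
        rw [Finset.inter_union_distrib_left]
        refine (Finset.card_union_le _ _).trans ?_
        have := h3 Y hY X hX hYX
        have := h3 Y hY L₁ hL₁ hYL
        omega
      exact not_meet_of_cost_three h1 h7 hb hbl hrank hwb hY (by simp [hYX, hYL]) hcY hwY
        (Finset.nonempty_iff_ne_empty.2 hne) ho
    have hc := Finset.card_le_card hcover
    have hu := Finset.card_union_le ({X, L₁} : Finset (Finset β)) (ls.filter (fun L => Disjoint L (unionL [X, L₁])))
    have h2' : ({X, L₁} : Finset (Finset β)).card ≤ 2 := Finset.card_le_two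
    omega
  · push Not at hex
    have hb : ([L₁] : List (Finset β)).Nodup := List.nodup_singleton L₁
    have hbl : ∀ L ∈ ([L₁] : List (Finset β)), L ∈ ls := by simp [hL₁]
    have hcost : 5 + lineRank [L₁] ≤ 3 + wsum w (unionL [L₁]) := by
      simp only [unionL, lineRank, Finset.union_empty, Finset.sdiff_empty, Finset.inter_empty, Finset.card_empty,
        Nat.zero_add]
      rw [show (2 - min 0 2 : ℕ) = 2 by decide, hw4]
      have : min L₁.card 2 ≤ 2 := min_le_right _ _
      omega
    have hD := card_filter_disjoint_le_four h1 h2 h3 h4 hb hbl hcost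
    have hcover : ls ⊆ ({L₁} : Finset (Finset β)) ∪ ls.filter (fun L => Disjoint L (unionL [L₁])) := by
      intro Y hY
      rw [Finset.mem_union, Finset.mem_singleton]
      by_cases hYL : Y = L₁
      · exact Or.inl hYL
      refine Or.inr (Finset.mem_filter.2 ⟨hY, ?_⟩)
      simp only [unionL, Finset.union_empty]
      rw [Finset.disjoint_iff_inter_eq_empty]
      exact hex Y hY hYL
    have hc := Finset.card_le_card hcover
    have hu := Finset.card_union_le ({L₁} : Finset (Finset β)) (ls.filter (fun L => Disjoint L (unionL [L₁])))
    rw [Finset.card_singleton] at hu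
    omega

/-- A one-fat 3-point line through a fat point has weight `1` at its other points. -/
theorem weight_one_of_ne_fat {L : Finset β} (hw : ∀ v ∈ L, w v = 1 ∨ w v = 2) (hc : L.card = 3) (hwL : wsum w L = 4)
    {p : β} (hp : p ∈ L) (hp2 : w p = 2) {q : β} (hq : q ∈ L) (hqp : q ≠ p) : w q = 1 := by
  rcases hw q hq with h | h
  · exact h
  · exfalso
    have hf : fat w L = 1 := by
      have := wsum_eq_card_add_fat w L hw; omega
    have hsub : ({p, q} : Finset β) ⊆ L.filter (fun v => w v = 2) := by
      intro x hx
      simp only [Finset.mem_insert, Finset.mem_singleton] at hx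
      rcases hx with rfl | rfl
      · exact Finset.mem_filter.2 ⟨hp, hp2⟩
      · exact Finset.mem_filter.2 ⟨hq, h⟩
    have := Finset.card_le_card hsub
    rw [Finset.card_pair (Ne.symm hqp)] at this
    unfold fat at hf
    omega

include h1 h3 h7 in
/-- **Every one-fat line passes through the fat point of any other**: a one-fat 3-point line `L'` avoiding the fat point `p` of the
one-fat 3-point line `F` meets `F` in `≤ 1` simple point, so the two-line list has `lineRank 4 − |L' ∩ F|` and weight `8 − |L' ∩ F|`. -/
theorem fat_line_through {F L' : Finset β} (hF : F ∈ ls) (hL' : L' ∈ ls) (hne : L' ≠ F) (hcF : F.card = 3)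
    (hwF : wsum w F = 4) {p : β} (hp : p ∈ F) (hp2 : w p = 2) (hcL' : L'.card = 3) (hwL' : wsum w L' = 4) : p ∈ L' := by
  by_contra hpL'
  have hint : (L' ∩ F).card ≤ 1 := h3 L' hL' F hF hne
  have hsd : (L' \ F).card + (L' ∩ F).card = L'.card := Finset.card_sdiff_add_card_inter _ _
  have hr : min F.card 2 + min (L' \ F).card (2 - min (L' ∩ F).card 2) ≤ 4 := by
    have : min F.card 2 ≤ 2 := min_le_right _ _
    have : min (L' \ F).card (2 - min (L' ∩ F).card 2) ≤ 2 - min (L' ∩ F).card 2 := min_le_right _ _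
    omega
  have hc := two_line_spread h7 hF hL' hne hr
  have hwu : wsum w (L' ∪ F) = wsum w F + wsum w (L' \ F) := by
    rw [Finset.union_comm]; exact (wsum_union_ge w _ _).symm
  -- the points of `L'` on `F` are simple, so `L' ∖ F` carries the fat point of `L'`
  have hfL' : fat w L' = 1 := by
    have := wsum_eq_card_add_fat w L' (h1 L' hL'); omega
  have hfint : fat w (L' ∩ F) = 0 := by
    unfold fat
    rw [Finset.card_eq_zero, Finset.filter_eq_empty_iff]
    intro q hq hq2
    have hqF := (Finset.mem_inter.1 hq).2
    have hqp : q ≠ p := fun h => hpL' (h ▸ (Finset.mem_inter.1 hq).1)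
    have := weight_one_of_ne_fat (h1 F hF) hcF hwF hp hp2 hqF hqp
    omega
  have hsplit := fat_sdiff_add_fat_inter w L' F
  have hwsd := wsum_sdiff_eq w L' F (h1 L' hL')
  have : min (L' \ F).card (2 - min (L' ∩ F).card 2) ≤ 2 - min (L' ∩ F).card 2 := min_le_right _ _
  have : min F.card 2 = 2 := min_eq_right (by omega)
  have : min (L' ∩ F).card 2 = (L' ∩ F).card := min_eq_left (by omega)
  omega

include h1 h3 h7 in
/-- **No three one-fat lines through a fat point**: the list `[F₃, F₂, F₁]` has `lineRank 2 + 1 + 1 = 4` and weight `2 + 6 = 8`. -/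
theorem not_three_through_fat {F₁ F₂ F₃ : Finset β} (hF₁ : F₁ ∈ ls) (hF₂ : F₂ ∈ ls) (hF₃ : F₃ ∈ ls) (h21 : F₂ ≠ F₁)
    (h31 : F₃ ≠ F₁) (h32 : F₃ ≠ F₂) (hc₁ : F₁.card = 3) (hc₂ : F₂.card = 3) (hc₃ : F₃.card = 3) (hw₁ : wsum w F₁ = 4)
    (hw₂ : wsum w F₂ = 4) (hw₃ : wsum w F₃ = 4) {p : β} (hp₁ : p ∈ F₁) (hp₂ : p ∈ F₂) (hp₃ : p ∈ F₃) (hp2 : w p = 2) :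
    False := by
  have hw : ∀ L ∈ ls, ∀ v ∈ L, 1 ≤ w v := fun L hL v hv => by rcases h1 L hL v hv with h | h <;> omega
  obtain ⟨a1, b1, c1, d1⟩ := cost_step w F₁ [] (hw F₁ hF₁)
  obtain ⟨a2, b2, c2, d2⟩ := cost_step w F₂ [F₁] (hw F₂ hF₂)
  obtain ⟨a3, b3, c3, d3⟩ := cost_step w F₃ [F₂, F₁] (hw F₃ hF₃)
  obtain ⟨e0, e1, e2, e3⟩ := cost_start w F₁
  -- the intersections are exactly `{p}`
  have i21 : F₂ ∩ unionL [F₁] = {p} := by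
    simp only [unionL, Finset.union_empty]
    refine Finset.eq_singleton_iff_unique_mem.2 ⟨Finset.mem_inter.2 ⟨hp₂, hp₁⟩, fun x hx => ?_⟩
    exact Finset.card_le_one.1 (h3 F₂ hF₂ F₁ hF₁ h21) x hx p (Finset.mem_inter.2 ⟨hp₂, hp₁⟩)
  have i3 : F₃ ∩ unionL [F₂, F₁] = {p} := by
    simp only [unionL, Finset.union_empty]
    refine Finset.eq_singleton_iff_unique_mem.2 ⟨Finset.mem_inter.2 ⟨hp₃, Finset.mem_union_left _ hp₂⟩, fun x hx => ?_⟩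
    rw [Finset.mem_inter, Finset.mem_union] at hx
    rcases hx with ⟨hx3, hx2 | hx1⟩
    · exact Finset.card_le_one.1 (h3 F₃ hF₃ F₂ hF₂ h32) x (Finset.mem_inter.2 ⟨hx3, hx2⟩) p
        (Finset.mem_inter.2 ⟨hp₃, hp₂⟩)
    · exact Finset.card_le_one.1 (h3 F₃ hF₃ F₁ hF₁ h31) x (Finset.mem_inter.2 ⟨hx3, hx1⟩) p
        (Finset.mem_inter.2 ⟨hp₃, hp₁⟩)
  -- the fat point is in the intersections, so the parts off the union have no fat point
  have hf₂ : fat w F₂ = 1 := by have := wsum_eq_card_add_fat w F₂ (h1 F₂ hF₂); omega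
  have hf₃ : fat w F₃ = 1 := by have := wsum_eq_card_add_fat w F₃ (h1 F₃ hF₃); omega
  have hfi2 : 1 ≤ fat w (F₂ ∩ unionL [F₁]) := by
    unfold fat
    exact Finset.card_pos.2 ⟨p, Finset.mem_filter.2 ⟨i21 ▸ Finset.mem_singleton_self p, hp2⟩⟩
  have hfi3 : 1 ≤ fat w (F₃ ∩ unionL [F₂, F₁]) := by
    unfold fat
    exact Finset.card_pos.2 ⟨p, Finset.mem_filter.2 ⟨i3 ▸ Finset.mem_singleton_self p, hp2⟩⟩
  have hs2 := fat_sdiff_add_fat_inter w F₂ (unionL [F₁])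
  have hs3 := fat_sdiff_add_fat_inter w F₃ (unionL [F₂, F₁])
  have hw2 := wsum_sdiff_eq w F₂ (unionL [F₁]) (h1 F₂ hF₂)
  have hw3 := wsum_sdiff_eq w F₃ (unionL [F₂, F₁]) (h1 F₃ hF₃)
  have ci2 : (F₂ ∩ unionL [F₁]).card = 1 := by rw [i21]; simp
  have ci3 : (F₃ ∩ unionL [F₂, F₁]).card = 1 := by rw [i3]; simp
  have hsp := h7 [F₃, F₂, F₁] (by simp [h21, h31, h32]) (by simp [hF₁, hF₂, hF₃]) (by rw [c3, c2, c1, e1]; omega)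
  rw [c3, c2, c1, e1, a3, a2, a1, e0] at hsp
  omega

include h1 h2 h3 h4 h7 in
/-- **Two one-fat lines through their fat point leave room for at most two simple lines**: every simple 3-point line is disjoint from
both (`not_meet_of_cost_three` on the base `[F₂, F₁]` of rank `3` and weight `6`), and the base has cost `3`. -/
theorem card_le_four_of_two_fat {F₁ F₂ : Finset β} (hF₁ : F₁ ∈ ls) (hF₂ : F₂ ∈ ls) (h21 : F₂ ≠ F₁) (hc₁ : F₁.card = 3)
    (hc₂ : F₂.card = 3) (hw₁ : wsum w F₁ = 4) (hw₂ : wsum w F₂ = 4) {p : β} (hp₁ : p ∈ F₁) (hp₂ : p ∈ F₂) (hp2 : w p = 2)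
    (hoth : ∀ L ∈ ls, L ≠ F₁ → L ≠ F₂ → L.card = 3 ∧ wsum w L = 3) : ls.card ≤ 4 := by
  have hw : ∀ L ∈ ls, ∀ v ∈ L, 1 ≤ w v := fun L hL v hv => by rcases h1 L hL v hv with h | h <;> omega
  -- the base `[F₂, F₁]`: rank `3`, weight `6`
  have i21 : F₂ ∩ F₁ = {p} := by
    refine Finset.eq_singleton_iff_unique_mem.2 ⟨Finset.mem_inter.2 ⟨hp₂, hp₁⟩, fun x hx => ?_⟩
    exact Finset.card_le_one.1 (h3 F₂ hF₂ F₁ hF₁ h21) x hx p (Finset.mem_inter.2 ⟨hp₂, hp₁⟩)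
  have hf₂ : fat w F₂ = 1 := by have := wsum_eq_card_add_fat w F₂ (h1 F₂ hF₂); omega
  have hfi2 : 1 ≤ fat w (F₂ ∩ F₁) := by
    unfold fat
    exact Finset.card_pos.2 ⟨p, Finset.mem_filter.2 ⟨i21 ▸ Finset.mem_singleton_self p, hp2⟩⟩
  have hs2 := fat_sdiff_add_fat_inter w F₂ F₁
  have hw2 := wsum_sdiff_eq w F₂ F₁ (h1 F₂ hF₂)
  have ci2 : (F₂ ∩ F₁).card = 1 := by rw [i21]; simp
  have hsd : (F₂ \ F₁).card + (F₂ ∩ F₁).card = F₂.card := Finset.card_sdiff_add_card_inter _ _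
  have hwu : wsum w (F₂ ∪ F₁) = wsum w F₁ + wsum w (F₂ \ F₁) := by
    rw [Finset.union_comm]; exact (wsum_union_ge w _ _).symm
  have hrank : lineRank [F₂, F₁] = 3 := by
    simp only [unionL, lineRank, Finset.union_empty, Finset.sdiff_empty, Finset.inter_empty, Finset.card_empty,
      Nat.zero_add]
    rw [show (2 - min 0 2 : ℕ) = 2 by decide, ci2]
    have : min F₁.card 2 = 2 := min_eq_right (by omega)
    omega
  have hwb : wsum w (unionL [F₂, F₁]) = 6 := by
    simp only [unionL, Finset.union_empty]
    omega
  have hb : ([F₂, F₁] : List (Finset β)).Nodup := by simp [h21]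
  have hbl : ∀ L ∈ ([F₂, F₁] : List (Finset β)), L ∈ ls := by simp [hF₁, hF₂]
  have hD := card_filter_disjoint_le_two h1 h2 h3 h4 hb hbl (by rw [hrank, hwb])
  have hcover : ls ⊆ ({F₂, F₁} : Finset (Finset β)) ∪ ls.filter (fun L => Disjoint L (unionL [F₂, F₁])) := by
    intro Y hY
    rw [Finset.mem_union, Finset.mem_insert, Finset.mem_singleton]
    by_cases hY2 : Y = F₂
    · exact Or.inl (Or.inl hY2)
    by_cases hY1 : Y = F₁
    · exact Or.inl (Or.inr hY1)
    refine Or.inr (Finset.mem_filter.2 ⟨hY, ?_⟩)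
    rw [Finset.disjoint_iff_inter_eq_empty]
    by_contra hne
    obtain ⟨hcY, hwY⟩ := hoth Y hY hY1 hY2
    have ho : (Y ∩ unionL [F₂, F₁]).card ≤ 2 := by
      simp only [unionL, Finset.union_empty]
      rw [Finset.inter_union_distrib_left]
      refine (Finset.card_union_le _ _).trans ?_
      have := h3 Y hY F₂ hF₂ hY2
      have := h3 Y hY F₁ hF₁ hY1
      omega
    exact not_meet_of_cost_three h1 h7 hb hbl hrank hwb hY (by simp [hY1, hY2]) hcY hwY
      (Finset.nonempty_iff_ne_empty.2 hne) ho
  have hc := Finset.card_le_card hcover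
  have hu := Finset.card_union_le ({F₂, F₁} : Finset (Finset β)) (ls.filter (fun L => Disjoint L (unionL [F₂, F₁])))
  have h2' : ({F₂, F₁} : Finset (Finset β)).card ≤ 2 := Finset.card_le_two
  omega

end Heavy

end FourCap

end S1

end PercRepro
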